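import Summits.ABC.IUTFork.Repair.RHHullThresholdExact
import HarnessLib

/-!
# HEX family `λ_k = 1/2 + 2/7^k` (part A: members `A ∈ {1, 2, 3, 5}`): the top-label hull cell at `p = 7` FAILS at every odd level `11 ≤ l ≤ 479` for every member of the sharp kernel
# class, UNIFORMLY in `k ≥ 10` — the integer side of the M-line REF glue below the `481 …` bands (row «W:REF-EXACT-M-TWIN», HEX part)

PROOF-ONLY file (D-0012; 0 definitions, 0 `Prop` facts, no instance) of the abc-iut cell — D-0079 RESCUE sub-cell R-W «WINDOW Θ-SIDE INEQUALITY», seat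
abc-iut-W-neg-1 (gen 6). PURE ARITHMETIC (abc-iut-rh-typ-4's `HullThresholdExact.HullCell`, the column of R-H row 4), in the byte shape of
abc-iut-C-cert-1's `RefBand.not_hullCell_hex<k>_A<A>_a<a₀>` / `RefBand.cells_hex<k>_band` (`WRowHexLamSeven<K>RefutedCells`): those start at `l = 481`
because on the K line the range `11 ≤ l ≤ 479` is abc-iut-W-neg-2's explicit-depth rad theorem `HexRad.not_pilotKummerCompatHull_lamSeven_rad_eleven`
(`k ≥ 11`), which has no M-line twin. The M-line hull-cell engine (this seat's `GenuineM.not_pilotKummerCompatHull_triple_of_hullCells_tameSharp`,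
p528325) needs only the failing cells, and at `p = 7`, `v = k` they fail on the WHOLE low range for EVERY `k ≥ 10` (desk: exact integers, every odd
`l`, every class member, floor-free margin positive at the least admissible `k` and increasing in `k`):

* `RefBand.not_hullCell_hexlow_A<A>_a<a₀>` — for each `A ∣ 30` and each turning-point piece (`7^{a₀−1}·6 < A·l ≤ 7^{a₀}·6`) of `11 ≤ l = 2j+1 ≤ 479`:
  `k ≥ k_A` (the least `k ≥ 10` compatible with the sharp class clauses for that `A`: `15 ∣ A·k`, `k` even ⇒ `A ∣ 15`, `3 ∣ k ⇒ A ∣ 10`,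
  `5 ∣ k ⇒ A ∣ 6`) and ANY inner radius with `6·r_in ≤ A·l + 6` ⟹ `¬ HullCell (A·l) (A·k) j r_in (7^{a₀} − a₀·A·l)` (`e·⌊X/e⌋ ≥ X − e + 1`; the margin
  is linear INCREASING in `k` and a downward parabola in `j` positive on the piece — `nlinarith`);
* **`RefBand.cells_hex_low`** — `10 ≤ k`, odd `11 ≤ l ≤ 479`, top label `i + 1 = (l−1)/2`, `A` in the sharp class at `(p, v) = (7, k)` ⟹ the engine's
  `hcell` conclusion `∃ a₀, (turning point of A·l at 7) ∧ ¬ HullCell (A·l) (A·k) (i+1) (⌊A·l/6⌋+1) (7^{a₀} − a₀·A·l)`.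
Consumers: the M twins `GenuineM.not_pilotKummerCompatHull_triple_lamSeven_<k>_le` (this row), gluing this with the `481 …` band cells of
abc-iut-C-cert-1 / abc-iut-w6-d055 BY NAME. HONEST SCOPE: integer inequalities only; nothing about any datum, (P6), admissibility or [IUTchIII] Cor. 3.12;
no side taken; no abc claim. [cite: Mochizuki2012, IUTchIV Prop. 1.1 p. 9, Prop. 1.2 (i)(ii) p. 10] [cite: DupuyHilado2025, §4.9] [claim: Mochizuki2012, status: disputed]
-/

noncomputable section

namespace Summit.ABC.IUTFork.Conditional

open Summit.ABC.IUTFork.Repair.RH.HullThresholdExact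

/-! ## §1. Floor-free failure per class member and turning-point piece, uniformly in `k` -/
/-- Floor-free failure of the top-label cell at `p = 7`, member `A = 1` (`e = 1l`, `m = 1k`), turning point `a₀ = 1` (`r_out = 7 − 1·1l`),
every `5 ≤ j ≤ 20` (`l = 2j + 1`), every `k ≥ 15`, ANY inner radius with `6·r_in ≤ 1l + 6`: the margin is increasing in `k` and a downward parabola in `j`
positive on the piece. [folklore] -/
theorem RefBand.not_hullCell_hexlow_A1_a1 {j k rin : ℤ} (hk : 15 ≤ k) (hlo : 5 ≤ j) (hhi : j ≤ 20) (hrin : 6 * rin ≤ 1 * (2 * j + 1) + 6) :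
    ¬ HullCell (1 * (2 * j + 1)) (1 * k) j rin (7 - 1 * (1 * (2 * j + 1))) := by
  intro hc
  unfold HullCell at hc
  set e : ℤ := 1 * (2 * j + 1) with he
  have he0 : 0 < e := by rw [he]; omega
  set X : ℤ := j ^ 2 * (1 * k) - j * (e - 1) - (j + 1) * rin with hX
  have hdiv : X - e < e * (X / e) := by
    have h1 := Int.emod_add_mul_ediv X e
    have h2 := Int.emod_lt_of_pos X he0
    have h3 := Int.emod_nonneg X he0.ne'
    nlinarith [h1, h2, h3]
  have hk1 : 0 ≤ (20 - j) * (j + 1) := mul_nonneg (by omega) (by omega)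
  have hk2 : 0 ≤ (20 - j) * (j - 5) := mul_nonneg (by omega) (by omega)
  have hk3 : 0 ≤ (k - 15) * (j ^ 2 - 1) := mul_nonneg (by omega) (by nlinarith)
  have hk4 : 0 ≤ (k - 15) * ((j + 1) * (j - 1)) := mul_nonneg (by omega) (mul_nonneg (by omega) (by omega))
  nlinarith [hdiv, hk1, hk2, hk3, hk4, hc, hrin, hX]

/-- Floor-free failure of the top-label cell at `p = 7`, member `A = 1` (`e = 1l`, `m = 1k`), turning point `a₀ = 2` (`r_out = 49 − 2·1l`),
every `21 ≤ j ≤ 146` (`l = 2j + 1`), every `k ≥ 15`, ANY inner radius with `6·r_in ≤ 1l + 6`: the margin is increasing in `k` and a downward parabola in `j`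
positive on the piece. [folklore] -/
theorem RefBand.not_hullCell_hexlow_A1_a2 {j k rin : ℤ} (hk : 15 ≤ k) (hlo : 21 ≤ j) (hhi : j ≤ 146) (hrin : 6 * rin ≤ 1 * (2 * j + 1) + 6) :
    ¬ HullCell (1 * (2 * j + 1)) (1 * k) j rin (49 - 2 * (1 * (2 * j + 1))) := by
  intro hc
  unfold HullCell at hc
  set e : ℤ := 1 * (2 * j + 1) with he
  have he0 : 0 < e := by rw [he]; omega
  set X : ℤ := j ^ 2 * (1 * k) - j * (e - 1) - (j + 1) * rin with hX
  have hdiv : X - e < e * (X / e) := by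
    have h1 := Int.emod_add_mul_ediv X e
    have h2 := Int.emod_lt_of_pos X he0
    have h3 := Int.emod_nonneg X he0.ne'
    nlinarith [h1, h2, h3]
  have hk1 : 0 ≤ (146 - j) * (j + 1) := mul_nonneg (by omega) (by omega)
  have hk2 : 0 ≤ (146 - j) * (j - 21) := mul_nonneg (by omega) (by omega)
  have hk3 : 0 ≤ (k - 15) * (j ^ 2 - 1) := mul_nonneg (by omega) (by nlinarith)
  have hk4 : 0 ≤ (k - 15) * ((j + 1) * (j - 1)) := mul_nonneg (by omega) (mul_nonneg (by omega) (by omega))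
  nlinarith [hdiv, hk1, hk2, hk3, hk4, hc, hrin, hX]

/-- Floor-free failure of the top-label cell at `p = 7`, member `A = 1` (`e = 1l`, `m = 1k`), turning point `a₀ = 3` (`r_out = 343 − 3·1l`),
every `147 ≤ j ≤ 239` (`l = 2j + 1`), every `k ≥ 15`, ANY inner radius with `6·r_in ≤ 1l + 6`: the margin is increasing in `k` and a downward parabola in `j`
positive on the piece. [folklore] -/
theorem RefBand.not_hullCell_hexlow_A1_a3 {j k rin : ℤ} (hk : 15 ≤ k) (hlo : 147 ≤ j) (hhi : j ≤ 239) (hrin : 6 * rin ≤ 1 * (2 * j + 1) + 6) :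
    ¬ HullCell (1 * (2 * j + 1)) (1 * k) j rin (343 - 3 * (1 * (2 * j + 1))) := by
  intro hc
  unfold HullCell at hc
  set e : ℤ := 1 * (2 * j + 1) with he
  have he0 : 0 < e := by rw [he]; omega
  set X : ℤ := j ^ 2 * (1 * k) - j * (e - 1) - (j + 1) * rin with hX
  have hdiv : X - e < e * (X / e) := by
    have h1 := Int.emod_add_mul_ediv X e
    have h2 := Int.emod_lt_of_pos X he0
    have h3 := Int.emod_nonneg X he0.ne'
    nlinarith [h1, h2, h3]
  have hk1 : 0 ≤ (239 - j) * (j + 1) := mul_nonneg (by omega) (by omega)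
  have hk2 : 0 ≤ (239 - j) * (j - 147) := mul_nonneg (by omega) (by omega)
  have hk3 : 0 ≤ (k - 15) * (j ^ 2 - 1) := mul_nonneg (by omega) (by nlinarith)
  have hk4 : 0 ≤ (k - 15) * ((j + 1) * (j - 1)) := mul_nonneg (by omega) (mul_nonneg (by omega) (by omega))
  nlinarith [hdiv, hk1, hk2, hk3, hk4, hc, hrin, hX]

/-- Floor-free failure of the top-label cell at `p = 7`, member `A = 2` (`e = 2l`, `m = 2k`), turning point `a₀ = 1` (`r_out = 7 − 1·2l`),
every `5 ≤ j ≤ 10` (`l = 2j + 1`), every `k ≥ 15`, ANY inner radius with `6·r_in ≤ 2l + 6`: the margin is increasing in `k` and a downward parabola in `j`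
positive on the piece. [folklore] -/
theorem RefBand.not_hullCell_hexlow_A2_a1 {j k rin : ℤ} (hk : 15 ≤ k) (hlo : 5 ≤ j) (hhi : j ≤ 10) (hrin : 6 * rin ≤ 2 * (2 * j + 1) + 6) :
    ¬ HullCell (2 * (2 * j + 1)) (2 * k) j rin (7 - 1 * (2 * (2 * j + 1))) := by
  intro hc
  unfold HullCell at hc
  set e : ℤ := 2 * (2 * j + 1) with he
  have he0 : 0 < e := by rw [he]; omega
  set X : ℤ := j ^ 2 * (2 * k) - j * (e - 1) - (j + 1) * rin with hX
  have hdiv : X - e < e * (X / e) := by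
    have h1 := Int.emod_add_mul_ediv X e
    have h2 := Int.emod_lt_of_pos X he0
    have h3 := Int.emod_nonneg X he0.ne'
    nlinarith [h1, h2, h3]
  have hk1 : 0 ≤ (10 - j) * (j + 1) := mul_nonneg (by omega) (by omega)
  have hk2 : 0 ≤ (10 - j) * (j - 5) := mul_nonneg (by omega) (by omega)
  have hk3 : 0 ≤ (k - 15) * (j ^ 2 - 1) := mul_nonneg (by omega) (by nlinarith)
  have hk4 : 0 ≤ (k - 15) * ((j + 1) * (j - 1)) := mul_nonneg (by omega) (mul_nonneg (by omega) (by omega))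
  nlinarith [hdiv, hk1, hk2, hk3, hk4, hc, hrin, hX]

/-- Floor-free failure of the top-label cell at `p = 7`, member `A = 2` (`e = 2l`, `m = 2k`), turning point `a₀ = 2` (`r_out = 49 − 2·2l`),
every `11 ≤ j ≤ 73` (`l = 2j + 1`), every `k ≥ 15`, ANY inner radius with `6·r_in ≤ 2l + 6`: the margin is increasing in `k` and a downward parabola in `j`
positive on the piece. [folklore] -/
theorem RefBand.not_hullCell_hexlow_A2_a2 {j k rin : ℤ} (hk : 15 ≤ k) (hlo : 11 ≤ j) (hhi : j ≤ 73) (hrin : 6 * rin ≤ 2 * (2 * j + 1) + 6) :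
    ¬ HullCell (2 * (2 * j + 1)) (2 * k) j rin (49 - 2 * (2 * (2 * j + 1))) := by
  intro hc
  unfold HullCell at hc
  set e : ℤ := 2 * (2 * j + 1) with he
  have he0 : 0 < e := by rw [he]; omega
  set X : ℤ := j ^ 2 * (2 * k) - j * (e - 1) - (j + 1) * rin with hX
  have hdiv : X - e < e * (X / e) := by
    have h1 := Int.emod_add_mul_ediv X e
    have h2 := Int.emod_lt_of_pos X he0
    have h3 := Int.emod_nonneg X he0.ne'
    nlinarith [h1, h2, h3]
  have hk1 : 0 ≤ (73 - j) * (j + 1) := mul_nonneg (by omega) (by omega)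
  have hk2 : 0 ≤ (73 - j) * (j - 11) := mul_nonneg (by omega) (by omega)
  have hk3 : 0 ≤ (k - 15) * (j ^ 2 - 1) := mul_nonneg (by omega) (by nlinarith)
  have hk4 : 0 ≤ (k - 15) * ((j + 1) * (j - 1)) := mul_nonneg (by omega) (mul_nonneg (by omega) (by omega))
  nlinarith [hdiv, hk1, hk2, hk3, hk4, hc, hrin, hX]

/-- Floor-free failure of the top-label cell at `p = 7`, member `A = 2` (`e = 2l`, `m = 2k`), turning point `a₀ = 3` (`r_out = 343 − 3·2l`),
every `74 ≤ j ≤ 239` (`l = 2j + 1`), every `k ≥ 15`, ANY inner radius with `6·r_in ≤ 2l + 6`: the margin is increasing in `k` and a downward parabola in `j`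
positive on the piece. [folklore] -/
theorem RefBand.not_hullCell_hexlow_A2_a3 {j k rin : ℤ} (hk : 15 ≤ k) (hlo : 74 ≤ j) (hhi : j ≤ 239) (hrin : 6 * rin ≤ 2 * (2 * j + 1) + 6) :
    ¬ HullCell (2 * (2 * j + 1)) (2 * k) j rin (343 - 3 * (2 * (2 * j + 1))) := by
  intro hc
  unfold HullCell at hc
  set e : ℤ := 2 * (2 * j + 1) with he
  have he0 : 0 < e := by rw [he]; omega
  set X : ℤ := j ^ 2 * (2 * k) - j * (e - 1) - (j + 1) * rin with hX
  have hdiv : X - e < e * (X / e) := by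
    have h1 := Int.emod_add_mul_ediv X e
    have h2 := Int.emod_lt_of_pos X he0
    have h3 := Int.emod_nonneg X he0.ne'
    nlinarith [h1, h2, h3]
  have hk1 : 0 ≤ (239 - j) * (j + 1) := mul_nonneg (by omega) (by omega)
  have hk2 : 0 ≤ (239 - j) * (j - 74) := mul_nonneg (by omega) (by omega)
  have hk3 : 0 ≤ (k - 15) * (j ^ 2 - 1) := mul_nonneg (by omega) (by nlinarith)
  have hk4 : 0 ≤ (k - 15) * ((j + 1) * (j - 1)) := mul_nonneg (by omega) (mul_nonneg (by omega) (by omega))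
  nlinarith [hdiv, hk1, hk2, hk3, hk4, hc, hrin, hX]

/-- Floor-free failure of the top-label cell at `p = 7`, member `A = 3` (`e = 3l`, `m = 3k`), turning point `a₀ = 1` (`r_out = 7 − 1·3l`),
every `5 ≤ j ≤ 6` (`l = 2j + 1`), every `k ≥ 10`, ANY inner radius with `6·r_in ≤ 3l + 6`: the margin is increasing in `k` and a downward parabola in `j`
positive on the piece. [folklore] -/
theorem RefBand.not_hullCell_hexlow_A3_a1 {j k rin : ℤ} (hk : 10 ≤ k) (hlo : 5 ≤ j) (hhi : j ≤ 6) (hrin : 6 * rin ≤ 3 * (2 * j + 1) + 6) :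
    ¬ HullCell (3 * (2 * j + 1)) (3 * k) j rin (7 - 1 * (3 * (2 * j + 1))) := by
  intro hc
  unfold HullCell at hc
  set e : ℤ := 3 * (2 * j + 1) with he
  have he0 : 0 < e := by rw [he]; omega
  set X : ℤ := j ^ 2 * (3 * k) - j * (e - 1) - (j + 1) * rin with hX
  have hdiv : X - e < e * (X / e) := by
    have h1 := Int.emod_add_mul_ediv X e
    have h2 := Int.emod_lt_of_pos X he0
    have h3 := Int.emod_nonneg X he0.ne'
    nlinarith [h1, h2, h3]
  have hk1 : 0 ≤ (6 - j) * (j + 1) := mul_nonneg (by omega) (by omega)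
  have hk2 : 0 ≤ (6 - j) * (j - 5) := mul_nonneg (by omega) (by omega)
  have hk3 : 0 ≤ (k - 10) * (j ^ 2 - 1) := mul_nonneg (by omega) (by nlinarith)
  have hk4 : 0 ≤ (k - 10) * ((j + 1) * (j - 1)) := mul_nonneg (by omega) (mul_nonneg (by omega) (by omega))
  nlinarith [hdiv, hk1, hk2, hk3, hk4, hc, hrin, hX]

/-- Floor-free failure of the top-label cell at `p = 7`, member `A = 3` (`e = 3l`, `m = 3k`), turning point `a₀ = 2` (`r_out = 49 − 2·3l`),
every `7 ≤ j ≤ 48` (`l = 2j + 1`), every `k ≥ 10`, ANY inner radius with `6·r_in ≤ 3l + 6`: the margin is increasing in `k` and a downward parabola in `j`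
positive on the piece. [folklore] -/
theorem RefBand.not_hullCell_hexlow_A3_a2 {j k rin : ℤ} (hk : 10 ≤ k) (hlo : 7 ≤ j) (hhi : j ≤ 48) (hrin : 6 * rin ≤ 3 * (2 * j + 1) + 6) :
    ¬ HullCell (3 * (2 * j + 1)) (3 * k) j rin (49 - 2 * (3 * (2 * j + 1))) := by
  intro hc
  unfold HullCell at hc
  set e : ℤ := 3 * (2 * j + 1) with he
  have he0 : 0 < e := by rw [he]; omega
  set X : ℤ := j ^ 2 * (3 * k) - j * (e - 1) - (j + 1) * rin with hX
  have hdiv : X - e < e * (X / e) := by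
    have h1 := Int.emod_add_mul_ediv X e
    have h2 := Int.emod_lt_of_pos X he0
    have h3 := Int.emod_nonneg X he0.ne'
    nlinarith [h1, h2, h3]
  have hk1 : 0 ≤ (48 - j) * (j + 1) := mul_nonneg (by omega) (by omega)
  have hk2 : 0 ≤ (48 - j) * (j - 7) := mul_nonneg (by omega) (by omega)
  have hk3 : 0 ≤ (k - 10) * (j ^ 2 - 1) := mul_nonneg (by omega) (by nlinarith)
  have hk4 : 0 ≤ (k - 10) * ((j + 1) * (j - 1)) := mul_nonneg (by omega) (mul_nonneg (by omega) (by omega))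
  nlinarith [hdiv, hk1, hk2, hk3, hk4, hc, hrin, hX]

/-- Floor-free failure of the top-label cell at `p = 7`, member `A = 3` (`e = 3l`, `m = 3k`), turning point `a₀ = 3` (`r_out = 343 − 3·3l`),
every `49 ≤ j ≤ 239` (`l = 2j + 1`), every `k ≥ 10`, ANY inner radius with `6·r_in ≤ 3l + 6`: the margin is increasing in `k` and a downward parabola in `j`
positive on the piece. [folklore] -/
theorem RefBand.not_hullCell_hexlow_A3_a3 {j k rin : ℤ} (hk : 10 ≤ k) (hlo : 49 ≤ j) (hhi : j ≤ 239) (hrin : 6 * rin ≤ 3 * (2 * j + 1) + 6) :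
    ¬ HullCell (3 * (2 * j + 1)) (3 * k) j rin (343 - 3 * (3 * (2 * j + 1))) := by
  intro hc
  unfold HullCell at hc
  set e : ℤ := 3 * (2 * j + 1) with he
  have he0 : 0 < e := by rw [he]; omega
  set X : ℤ := j ^ 2 * (3 * k) - j * (e - 1) - (j + 1) * rin with hX
  have hdiv : X - e < e * (X / e) := by
    have h1 := Int.emod_add_mul_ediv X e
    have h2 := Int.emod_lt_of_pos X he0
    have h3 := Int.emod_nonneg X he0.ne'
    nlinarith [h1, h2, h3]
  have hk1 : 0 ≤ (239 - j) * (j + 1) := mul_nonneg (by omega) (by omega)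
  have hk2 : 0 ≤ (239 - j) * (j - 49) := mul_nonneg (by omega) (by omega)
  have hk3 : 0 ≤ (k - 10) * (j ^ 2 - 1) := mul_nonneg (by omega) (by nlinarith)
  have hk4 : 0 ≤ (k - 10) * ((j + 1) * (j - 1)) := mul_nonneg (by omega) (mul_nonneg (by omega) (by omega))
  nlinarith [hdiv, hk1, hk2, hk3, hk4, hc, hrin, hX]

/-- Floor-free failure of the top-label cell at `p = 7`, member `A = 5` (`e = 5l`, `m = 5k`), turning point `a₀ = 2` (`r_out = 49 − 2·5l`),
every `5 ≤ j ≤ 28` (`l = 2j + 1`), every `k ≥ 12`, ANY inner radius with `6·r_in ≤ 5l + 6`: the margin is increasing in `k` and a downward parabola in `j`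
positive on the piece. [folklore] -/
theorem RefBand.not_hullCell_hexlow_A5_a2 {j k rin : ℤ} (hk : 12 ≤ k) (hlo : 5 ≤ j) (hhi : j ≤ 28) (hrin : 6 * rin ≤ 5 * (2 * j + 1) + 6) :
    ¬ HullCell (5 * (2 * j + 1)) (5 * k) j rin (49 - 2 * (5 * (2 * j + 1))) := by
  intro hc
  unfold HullCell at hc
  set e : ℤ := 5 * (2 * j + 1) with he
  have he0 : 0 < e := by rw [he]; omega
  set X : ℤ := j ^ 2 * (5 * k) - j * (e - 1) - (j + 1) * rin with hX
  have hdiv : X - e < e * (X / e) := by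
    have h1 := Int.emod_add_mul_ediv X e
    have h2 := Int.emod_lt_of_pos X he0
    have h3 := Int.emod_nonneg X he0.ne'
    nlinarith [h1, h2, h3]
  have hk1 : 0 ≤ (28 - j) * (j + 1) := mul_nonneg (by omega) (by omega)
  have hk2 : 0 ≤ (28 - j) * (j - 5) := mul_nonneg (by omega) (by omega)
  have hk3 : 0 ≤ (k - 12) * (j ^ 2 - 1) := mul_nonneg (by omega) (by nlinarith)
  have hk4 : 0 ≤ (k - 12) * ((j + 1) * (j - 1)) := mul_nonneg (by omega) (mul_nonneg (by omega) (by omega))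
  nlinarith [hdiv, hk1, hk2, hk3, hk4, hc, hrin, hX]

/-- Floor-free failure of the top-label cell at `p = 7`, member `A = 5` (`e = 5l`, `m = 5k`), turning point `a₀ = 3` (`r_out = 343 − 3·5l`),
every `29 ≤ j ≤ 205` (`l = 2j + 1`), every `k ≥ 12`, ANY inner radius with `6·r_in ≤ 5l + 6`: the margin is increasing in `k` and a downward parabola in `j`
positive on the piece. [folklore] -/
theorem RefBand.not_hullCell_hexlow_A5_a3 {j k rin : ℤ} (hk : 12 ≤ k) (hlo : 29 ≤ j) (hhi : j ≤ 205) (hrin : 6 * rin ≤ 5 * (2 * j + 1) + 6) :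
    ¬ HullCell (5 * (2 * j + 1)) (5 * k) j rin (343 - 3 * (5 * (2 * j + 1))) := by
  intro hc
  unfold HullCell at hc
  set e : ℤ := 5 * (2 * j + 1) with he
  have he0 : 0 < e := by rw [he]; omega
  set X : ℤ := j ^ 2 * (5 * k) - j * (e - 1) - (j + 1) * rin with hX
  have hdiv : X - e < e * (X / e) := by
    have h1 := Int.emod_add_mul_ediv X e
    have h2 := Int.emod_lt_of_pos X he0
    have h3 := Int.emod_nonneg X he0.ne'
    nlinarith [h1, h2, h3]
  have hk1 : 0 ≤ (205 - j) * (j + 1) := mul_nonneg (by omega) (by omega)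
  have hk2 : 0 ≤ (205 - j) * (j - 29) := mul_nonneg (by omega) (by omega)
  have hk3 : 0 ≤ (k - 12) * (j ^ 2 - 1) := mul_nonneg (by omega) (by nlinarith)
  have hk4 : 0 ≤ (k - 12) * ((j + 1) * (j - 1)) := mul_nonneg (by omega) (mul_nonneg (by omega) (by omega))
  nlinarith [hdiv, hk1, hk2, hk3, hk4, hc, hrin, hX]

/-- Floor-free failure of the top-label cell at `p = 7`, member `A = 5` (`e = 5l`, `m = 5k`), turning point `a₀ = 4` (`r_out = 2401 − 4·5l`),
every `206 ≤ j ≤ 239` (`l = 2j + 1`), every `k ≥ 12`, ANY inner radius with `6·r_in ≤ 5l + 6`: the margin is increasing in `k` and a downward parabola in `j`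
positive on the piece. [folklore] -/
theorem RefBand.not_hullCell_hexlow_A5_a4 {j k rin : ℤ} (hk : 12 ≤ k) (hlo : 206 ≤ j) (hhi : j ≤ 239) (hrin : 6 * rin ≤ 5 * (2 * j + 1) + 6) :
    ¬ HullCell (5 * (2 * j + 1)) (5 * k) j rin (2401 - 4 * (5 * (2 * j + 1))) := by
  intro hc
  unfold HullCell at hc
  set e : ℤ := 5 * (2 * j + 1) with he
  have he0 : 0 < e := by rw [he]; omega
  set X : ℤ := j ^ 2 * (5 * k) - j * (e - 1) - (j + 1) * rin with hX
  have hdiv : X - e < e * (X / e) := by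
    have h1 := Int.emod_add_mul_ediv X e
    have h2 := Int.emod_lt_of_pos X he0
    have h3 := Int.emod_nonneg X he0.ne'
    nlinarith [h1, h2, h3]
  have hk1 : 0 ≤ (239 - j) * (j + 1) := mul_nonneg (by omega) (by omega)
  have hk2 : 0 ≤ (239 - j) * (j - 206) := mul_nonneg (by omega) (by omega)
  have hk3 : 0 ≤ (k - 12) * (j ^ 2 - 1) := mul_nonneg (by omega) (by nlinarith)
  have hk4 : 0 ≤ (k - 12) * ((j + 1) * (j - 1)) := mul_nonneg (by omega) (mul_nonneg (by omega) (by omega))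
  nlinarith [hdiv, hk1, hk2, hk3, hk4, hc, hrin, hX]

end Summit.ABC.IUTFork.Conditional

end
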